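import Mathlib.LinearAlgebra.TensorProduct.Tower
import Mathlib.LinearAlgebra.DirectSum.Finsupp
import Mathlib.LinearAlgebra.FreeModule.Basic
import Literature.NumberTheory.GaloisRepresentations.GaloisCohomology
import HarnessLib

/-!
# Extension of coefficients `A ↦ 𝒪 ⊗_R A` of a continuous representation on a DISCRETE module
# (the erratum's `T = T_pE ⊗_{ℤ_p} 𝒪`, `A_f = E[p^∞] ⊗_{ℤ_p} 𝒪`)

Cell `bsd-stepL` (crux `stmt-BirchSwinnertonDyer-19270`, Road FF), the coefficient object of the
erratum's (b): "a `G_ℚ`-stable lattice `T_{g_m} ⊂ V_{g_m}` and an isomorphism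
`T_{g_m}/p^m T_{g_m} ≃ T/p^m T` as `𝒪[G_ℚ]`-modules" (Castella, Erratum p. 4; Skinner, Pacific J. Math.
283 (2016) §2.6 (2-6-1): "`T_f/p^m T_f = 𝕋 ⊗_{R,φ_0} 𝒪/p^m 𝒪 = … = T_{f_m}/p^m T_{f_m}` as
`𝒪[G_ℚ]`-modules", with "`L ⊂ ℚ̄_p` any finite extension of `ℚ_p` containing the image of `ℚ(f)` and
`𝒪` the ring of integers of `L`"), where for `f = f_E` with RATIONAL coefficients the lattice is
`T = T_pE ⊗_{ℤ_p} 𝒪` and the discrete module is `A_f = V/T = E[p^∞] ⊗_{ℤ_p} 𝒪`: the members `g_m`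
of the Hida family have coefficients in an `𝒪 ⊋ ℤ_p` in general, so the `E`-side of the
congruence must be read with coefficients EXTENDED to `𝒪`. DEFINITIONS WITH BODIES and proved
lemmas; no named fact, no `sorry`, no notation; instances only on the new carrier `CoeffExtension`.

## What is defined (namespace `Literature.NumberTheory.GaloisRepresentations`)

* `CoeffExtension R 𝒪 A := 𝒪 ⊗[R] A` (type synonym, so that the DISCRETE topology is local to it), with
  its `𝒪`-module structure and `R`-scalar tower from Mathlib's tensor product.
* **`ContinuousRep.extendScalars 𝒪 ρ : ContinuousRep G 𝒪 (CoeffExtension R 𝒪 A)`** for a continuous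
  `R`-linear representation `ρ` of a topological group `G` on a DISCRETE `A`: `g ↦ (ρ g) ⊗ 1`
  (Mathlib `LinearMap.baseChange`), jointly continuous for the discrete topology because the
  stabiliser of a finite sum of pure tensors contains the (open) stabilisers of the `A`-components
  (`ContinuousRep.ofStabilizerMemNhdsOne`, tensor induction); `extendScalars_apply_tmul`.
* The three elementary inputs of the erratum's Lemma 2.1 TRANSFER from `A` to `𝒪 ⊗ A`:
  `CoeffExtension.exists_nsmul_eq` (divisibility), `ContinuousRep.extendScalars_apply_eq_self`
  (elements acting trivially on `A` act trivially), and — for `𝒪` FREE over `R` —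
  **`ContinuousRep.forall_fixed_torsion_eq_zero_extendScalars`** ("no nonzero `G'`-fixed `n`-torsion
  in `A`" ⟹ the same in `𝒪 ⊗ A`: a basis `𝒪 ≅ R^{(ι)}` gives `𝒪 ⊗ A ≅ A^{(ι)}` equivariantly,
  Mathlib `finsuppScalarLeft`).

Intended use: `R = ℤ_[p]`, `A = E[p^∞]` (`PrimaryTorsion`, file `PrimaryTorsionGaloisRep.lean`),
`𝒪 = padicCoeffIntegers ι` of the Hida family's coefficient field; then
`AnticyclotomicBigGaloisRep κ ((W.primaryTorsionGaloisRep p).extendScalars 𝒪)` is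
`M_f = (T_pE ⊗ 𝒪) ⊗_𝒪 Λ_𝒪^*(Ψ⁻¹)` over `Λ_𝒪 = 𝒪⟦T⟧`, on the same ring as `M_{g_m}`.
-- TODO(general form): comparison `Sel(𝒪 ⊗ M) = 𝒪 ⊗ Sel(M)` / `X(𝒪 ⊗ M) ≅ 𝒪 ⊗ X(M)` (additivity of
-- continuous `H¹`), which carries Shapiro [SU14, Prop. 3.2.3] to `𝒪`-coefficients; not done here.

References: [Castella2018Erratum] §2 p. 4 (b); [Skinner2016PacificMC] §2.3 (`𝓜 = T_f ⊗_𝒪 Λ_𝒪^*`),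
§2.6 (2-6-1); [SerreGaloisCohomology1997] I §2.1 (discrete modules: open stabilisers).
-/

noncomputable section

open scoped TensorProduct
open Topology

universe u v w

namespace Literature.NumberTheory.GaloisRepresentations

/-! ### §1. The carrier `𝒪 ⊗_R A` with the discrete topology -/

section Carrier

variable (R : Type*) [CommRing R] (𝒪 : Type v) [CommRing 𝒪] [Algebra R 𝒪]
  (A : Type w) [AddCommGroup A] [Module R A]

/-- **`𝒪 ⊗_R A`** — the coefficient extension of the `R`-module `A` to the `R`-algebra `𝒪` (the
erratum's `T ⊗ 𝒪`, `A_f = E[p^∞] ⊗_{ℤ_p} 𝒪`), a type synonym of Mathlib's tensor product carrying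
the DISCRETE topology. [cite: Skinner2016PacificMC, §2.6 (2-6-1) ("T_f/p^m T_f = 𝕋 ⊗_{R,φ_0} 𝒪/p^m𝒪 … as 𝒪[G_ℚ]-modules")] -/
def CoeffExtension : Type _ := 𝒪 ⊗[R] A


namespace CoeffExtension

/-- `𝒪 ⊗ A` is an abelian group (Mathlib's tensor product). [folklore] -/
instance instAddCommGroup : AddCommGroup (CoeffExtension R 𝒪 A) :=
  inferInstanceAs (AddCommGroup (𝒪 ⊗[R] A))

/-- `𝒪 ⊗ A` is an `𝒪`-module (left factor). [folklore] -/
instance instModule : Module 𝒪 (CoeffExtension R 𝒪 A) :=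
  inferInstanceAs (Module 𝒪 (𝒪 ⊗[R] A))

/-- `𝒪 ⊗ A` is an `R`-module. [folklore] -/
instance instModuleBase : Module R (CoeffExtension R 𝒪 A) :=
  inferInstanceAs (Module R (𝒪 ⊗[R] A))

/-- The `R`- and `𝒪`-structures on `𝒪 ⊗ A` are compatible. [folklore] -/
instance instIsScalarTower : IsScalarTower R 𝒪 (CoeffExtension R 𝒪 A) :=
  inferInstanceAs (IsScalarTower R 𝒪 (𝒪 ⊗[R] A))

/-- The discrete topology on `𝒪 ⊗ A` (a discrete Galois module, like `A`). [cite: SerreGaloisCohomology1997, I §2.1 (discrete G-modules)] -/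
instance instTopologicalSpace : TopologicalSpace (CoeffExtension R 𝒪 A) := ⊥

/-- `𝒪 ⊗ A` is discrete by definition. [cite: SerreGaloisCohomology1997, I §2.1] -/
instance instDiscreteTopology : DiscreteTopology (CoeffExtension R 𝒪 A) := ⟨rfl⟩

variable {R 𝒪 A}

/-- The pure tensor `c ⊗ a ∈ 𝒪 ⊗ A`. [folklore] -/
def tmul (c : 𝒪) (a : A) : CoeffExtension R 𝒪 A := c ⊗ₜ[R] a

/-- Unfolding `tmul` (it is Mathlib's `⊗ₜ`). [cite: Skinner2016PacificMC, §2.6 (2-6-1) (the tensor T ⊗ 𝒪)] -/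
theorem tmul_def (c : 𝒪) (a : A) : (tmul c a : CoeffExtension R 𝒪 A) = (c ⊗ₜ[R] a : 𝒪 ⊗[R] A) := rfl

/-- Induction on `𝒪 ⊗ A`: zero, pure tensors, sums (Mathlib `TensorProduct.induction_on`). [cite: Skinner2016PacificMC, §2.6 (2-6-1) (the tensor T ⊗ 𝒪)] -/
@[elab_as_elim]
theorem induction_on {motive : CoeffExtension R 𝒪 A → Prop} (x : CoeffExtension R 𝒪 A)
    (zero : motive 0) (tmul : ∀ (c : 𝒪) (a : A), motive (CoeffExtension.tmul c a))
    (add : ∀ x y, motive x → motive y → motive (x + y)) : motive x :=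
  TensorProduct.induction_on (motive := motive) x zero tmul add

/-- **Divisibility transfers to `𝒪 ⊗ A`**: if `n •` is onto on `A` (e.g. `A = E[p^∞]`, `n = p`), it is
onto on `𝒪 ⊗ A` (pure tensors, then sums). [cite: Skinner2016PacificMC, §2.3, proof of Lemma 2.3.1 (divisibility of T ⊗ Λ^*)] -/
theorem exists_nsmul_eq {n : ℕ} (hA : ∀ a : A, ∃ b : A, n • b = a) (x : CoeffExtension R 𝒪 A) :
    ∃ y : CoeffExtension R 𝒪 A, n • y = x := by
  induction x using induction_on with
  | zero => exact ⟨0, smul_zero _⟩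
  | tmul c a =>
    obtain ⟨b, rfl⟩ := hA a
    exact ⟨CoeffExtension.tmul c b, by rw [tmul_def, tmul_def, TensorProduct.tmul_smul]; rfl⟩
  | add x y hx hy =>
    obtain ⟨x', rfl⟩ := hx
    obtain ⟨y', rfl⟩ := hy
    exact ⟨x' + y', smul_add _ _ _⟩

end CoeffExtension

end Carrier

/-! ### §2. The representation `ρ ⊗ 1` and its continuity -/

namespace ContinuousRep

variable {R : Type*} [CommRing R] [TopologicalSpace R] (𝒪 : Type v) [CommRing 𝒪] [Algebra R 𝒪]
  {A : Type w} [AddCommGroup A] [Module R A] [TopologicalSpace A]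
  {G : Type u} [Group G] [TopologicalSpace G]

/-- The `𝒪`-linear representation `g ↦ (ρ g) ⊗ 1` on `𝒪 ⊗ A` (Mathlib `LinearMap.baseChange`).
[cite: Skinner2016PacificMC, §2.6 (2-6-1) (the 𝒪[G_ℚ]-module T ⊗ 𝒪)] -/
def extendScalarsRepresentation (ρ : ContinuousRep G R A) :
    Representation 𝒪 G (CoeffExtension R 𝒪 A) where
  toFun g := ((ρ g).baseChange 𝒪 : 𝒪 ⊗[R] A →ₗ[𝒪] 𝒪 ⊗[R] A)
  map_one' := by
    change ((ρ 1).baseChange 𝒪 : 𝒪 ⊗[R] A →ₗ[𝒪] 𝒪 ⊗[R] A) = 1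
    rw [map_one, LinearMap.baseChange_one]
  map_mul' g h := by
    change ((ρ (g * h)).baseChange 𝒪 : 𝒪 ⊗[R] A →ₗ[𝒪] 𝒪 ⊗[R] A) =
      ((ρ g).baseChange 𝒪) * ((ρ h).baseChange 𝒪)
    rw [map_mul, LinearMap.baseChange_mul]

/-- Unfolding on pure tensors: `(ρ ⊗ 1)(g)(c ⊗ a) = c ⊗ ρ(g) a`. [cite: Skinner2016PacificMC, §2.6 (2-6-1)] -/
theorem extendScalarsRepresentation_apply_tmul (ρ : ContinuousRep G R A) (g : G) (c : 𝒪) (a : A) :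
    extendScalarsRepresentation 𝒪 ρ g (CoeffExtension.tmul c a) = CoeffExtension.tmul c (ρ g a) :=
  LinearMap.baseChange_tmul _ _ _

variable [TopologicalSpace 𝒪] [DiscreteTopology A] [ContinuousMul G]

/-- **`ρ ⊗ 1 : G → Aut_𝒪(𝒪 ⊗ A)` is a CONTINUOUS representation on the discrete module `𝒪 ⊗ A`**:
the stabiliser of `∑ cᵢ ⊗ aᵢ` contains `⋂ Stab_ρ(aᵢ)`, a neighbourhood of `1` because `ρ` is
continuous on the discrete `A` (`isOpen_setOf_apply_eq`); conclude by `ofStabilizerMemNhdsOne`.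
For `R = ℤ_p`, `A = E[p^∞]`: `A_f = E[p^∞] ⊗_{ℤ_p} 𝒪 = V/T`, `T = T_pE ⊗ 𝒪`, as a discrete
`𝒪[Γ_K]`-module. [cite: Castella2018Erratum, §2 p. 4 ((b): "as 𝒪[G_ℚ]-modules")] [cite: SerreGaloisCohomology1997, I §2.1] -/
def extendScalars (ρ : ContinuousRep G R A) : ContinuousRep G 𝒪 (CoeffExtension R 𝒪 A) :=
  ofStabilizerMemNhdsOne (extendScalarsRepresentation 𝒪 ρ) fun x => by
    induction x using CoeffExtension.induction_on with
    | zero => exact Filter.univ_mem' fun g => map_zero _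
    | tmul c a =>
      refine Filter.mem_of_superset ((ρ.isOpen_setOf_apply_eq a).mem_nhds (by simp)) fun g hg => ?_
      simp only [Set.mem_setOf_eq] at hg ⊢
      rw [extendScalarsRepresentation_apply_tmul, hg]
    | add x y hx hy =>
      refine Filter.mem_of_superset (Filter.inter_mem hx hy) fun g hg => ?_
      simp only [Set.mem_inter_iff, Set.mem_setOf_eq] at hg ⊢
      rw [map_add, hg.1, hg.2]

/-- Unfolding `extendScalars` on pure tensors: `ρ^𝒪(g)(c ⊗ a) = c ⊗ ρ(g) a`. [cite: Skinner2016PacificMC, §2.6 (2-6-1)] -/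
@[simp] theorem extendScalars_apply_tmul (ρ : ContinuousRep G R A) (g : G) (c : 𝒪) (a : A) :
    ρ.extendScalars 𝒪 g (CoeffExtension.tmul c a) = CoeffExtension.tmul c (ρ g a) :=
  extendScalarsRepresentation_apply_tmul 𝒪 ρ g c a

/-- **Trivial action transfers**: if `g` acts trivially on `A` (e.g. `g` in an inertia group at a
place of good reduction, `A = E[p^∞]`), it acts trivially on `𝒪 ⊗ A`. [cite: Castella2018Erratum, Lemma 2.1 (p. 2, "Σ contains all primes v ∤ p where T_g is ramified")] -/
theorem extendScalars_apply_eq_self (ρ : ContinuousRep G R A) {g : G} (hg : ∀ a : A, ρ g a = a)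
    (x : CoeffExtension R 𝒪 A) : ρ.extendScalars 𝒪 g x = x := by
  induction x using CoeffExtension.induction_on with
  | zero => exact map_zero _
  | tmul c a => rw [extendScalars_apply_tmul, hg]
  | add x y hx hy => rw [map_add, hx, hy]

/-! ### §3. `𝒪` free over `R`: `𝒪 ⊗ A ≅ A^{(ι)}` and the fixed-torsion input -/

/-- **"No nonzero fixed `n`-torsion" transfers to `𝒪 ⊗ A` when `𝒪` is free over `R`.** A basis
`𝒪 ≅ R^{(ι)}` gives an `R`-linear `𝒪 ⊗ A ≅ A^{(ι)}` (Mathlib `finsuppScalarLeft`) under which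
`ρ^𝒪(g)` acts componentwise by `ρ(g)`; so a fixed `n`-torsion element of `𝒪 ⊗ A` has fixed `n`-torsion
components, which vanish. For `A = E[p^∞]`, `n = p`: the inputs `E(K)[p] = 0` ∕ `E(K_𝔭)[p] = 0` of
erratum Lemma 2.1 for `A_f = E[p^∞] ⊗ 𝒪`. [cite: Castella2018Erratum, Lemma 2.1, proof (p. 2)] [cite: Skinner2016PacificMC, §2.3 (𝒪 free of finite rank over ℤ_p)] -/
theorem forall_fixed_torsion_eq_zero_extendScalars [Module.Free R 𝒪] (ρ : ContinuousRep G R A)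
    {ι' : Type*} (g : ι' → G) {n : ℕ}
    (hA : ∀ a : A, (∀ i, ρ (g i) a = a) → n • a = 0 → a = 0) :
    ∀ x : CoeffExtension R 𝒪 A, (∀ i, ρ.extendScalars 𝒪 (g i) x = x) → n • x = 0 → x = 0 := by
  classical
  -- a basis of `𝒪` over `R` and the induced `R`-linear `𝒪 ⊗ A ≃ (ι →₀ A)`
  let b := Module.Free.chooseBasis R 𝒪
  let e : CoeffExtension R 𝒪 A ≃ₗ[R] (Module.Free.ChooseBasisIndex R 𝒪 →₀ A) :=
    (TensorProduct.congr b.repr (LinearEquiv.refl R A)).trans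
      (TensorProduct.finsuppScalarLeft R A _)
  -- `e` is componentwise equivariant: `e (ρ^𝒪 g x) j = ρ g (e x j)`
  have he : ∀ (γ : G) (x : CoeffExtension R 𝒪 A) (j : Module.Free.ChooseBasisIndex R 𝒪),
      e (ρ.extendScalars 𝒪 γ x) j = ρ γ (e x j) := by
    intro γ x j
    induction x using CoeffExtension.induction_on with
    | zero => rw [map_zero, map_zero, Finsupp.zero_apply, map_zero]
    | tmul c a =>
      rw [extendScalars_apply_tmul]
      change TensorProduct.finsuppScalarLeft R A _ (b.repr c ⊗ₜ[R] ρ γ a) j =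
        ρ γ (TensorProduct.finsuppScalarLeft R A _ (b.repr c ⊗ₜ[R] a) j)
      rw [TensorProduct.finsuppScalarLeft_apply_tmul_apply,
        TensorProduct.finsuppScalarLeft_apply_tmul_apply, map_smul]
    | add x y hx hy => simp only [map_add, Finsupp.add_apply, hx, hy]
  intro x hx hn
  -- every component of `e x` is fixed and `n`-torsion, hence zero
  have hcomp : ∀ j, e x j = 0 := fun j =>
    hA (e x j) (fun i => by rw [← he, hx i]) (by rw [← Finsupp.smul_apply, ← map_nsmul, hn, map_zero,
      Finsupp.zero_apply])
  have hex : e x = 0 := Finsupp.ext hcomp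
  exact e.injective (by rw [hex, map_zero])

/-- The `p`-power-torsion form consumed by the kernel's criteria (`divisibleInvariants_bigRep`,
`divisibleInvariants_localMap_strictSet`): no nonzero fixed `p`-POWER torsion in `𝒪 ⊗ A` from no
nonzero fixed `p`-TORSION in `A` (a fixed `x` with `p^{k+1} x = 0` has `p • x` fixed with
`p^k (p • x) = 0`; induction). [cite: Castella2018Erratum, Lemma 2.1, proof (p. 2)] -/
theorem forall_fixed_primary_eq_zero_extendScalars [Module.Free R 𝒪] (ρ : ContinuousRep G R A)
    {ι' : Type*} (g : ι' → G) {p : ℕ}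
    (hA : ∀ a : A, (∀ i, ρ (g i) a = a) → p • a = 0 → a = 0) :
    ∀ x : CoeffExtension R 𝒪 A, (∀ i, ρ.extendScalars 𝒪 (g i) x = x) →
      (∃ k : ℕ, p ^ k • x = 0) → x = 0 := by
  have h1 := forall_fixed_torsion_eq_zero_extendScalars 𝒪 ρ g hA
  suffices key : ∀ (k : ℕ) (x : CoeffExtension R 𝒪 A),
      (∀ i, ρ.extendScalars 𝒪 (g i) x = x) → p ^ k • x = 0 → x = 0 by
    rintro x hx ⟨k, hk⟩
    exact key k x hx hk
  intro k
  induction k with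
  | zero => intro x _ hk; rwa [pow_zero, one_smul] at hk
  | succ k ih =>
    intro x hx hk
    have hpx : p • x = 0 := ih (p • x)
      (fun i => by rw [← Nat.cast_smul_eq_nsmul 𝒪, map_smul, hx i]) (by rw [← mul_smul, ← pow_succ, hk])
    exact h1 x hx hpx

end ContinuousRep

end Literature.NumberTheory.GaloisRepresentations

end
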